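import Summits.BirchSwinnertonDyer.BirchSwinnertonDyer.Theorems.GenusKolyvaginAtTwoMinimalTwinBSDTwoAnalyticTwin
import HarnessLib

/-!
# THE RANK-ONE TRANSFER AT EVERY PRIME `p` (index currency): for non-CM curves over `ℚ`, `BSD_p` in analytic rank 1 ⟸ `BSD_p` in analytic rank 0 +
# Friedberg–Hoffstein + PRINT + ONE research statement IDX_p (the `p`-primary Gross–Zagier index relation), LOSSLESS; hence, modulo PRINT + FH,
# «`BSD_p` for every non-CM curve of analytic rank `≤ 1`» ⟺ «`BSD_p` for every non-CM curve of analytic rank `0`» ∧ IDX_p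

Seat `bsd-line-gk2-p2` g27 (PROVER seat 2/3, cell `bsd-f1-sign2`, LINE 23 holder on U₂ stmt-BirchSwinnertonDyer-22985, route `GenusKolyvaginAtTwo`),
`--supports stmt-BirchSwinnertonDyer-22985` (helper; closes nothing).  THEOREMS ONLY; standard axioms.  **BSD is NOT proved by this file at any prime;
nothing is closed.**  This is the `p`-generic form of this seat's `RankOneTransfer` (p788609, `p = 2`): every input of that file is prime-generic — the exact
Gross–Zagier identity over `K` (`CMExactDescent.shaAnOverC_baseChange_eq_of_heegner`: `#Ш_an(W_K) = 4I²/(c² w_K² C(W)²)`, `I = [W(K):ℤP_K]`), Milne's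
any-model base change (`AdditivePotMult.bsdp_of_pPartOverC_baseChange` / `missingPPartOverCAt_baseChange_iff_bsdp`), the parity of the functional equation,
and Friedberg–Hoffstein (`friedbergHoffstein_exists_heegnerField_split_twist_ne_zero`, Literature, statement-only: a Heegner field with `p` split,
`|d_K| > 4`, `L(W^{(d_K)},1) ≠ 0` for `w(W) = −1`).  So for EVERY prime `p`:
* §1 `missingPPartOverCAt_baseChange_of_idx` — IDX_p at a frame ⟹ `MissingPPartOverCAt (W ⊗ K) p`;
* §2 ★ `bsdp_rankOne_of_rankZero_of_friedbergHoffstein_of_idx_of_facts` — **`BSD_p` for EVERY non-CM globally minimal `W` with `r_an = 1` ⟸ (`BSD_p` for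
  non-CM rank-`0` curves) + FH + IDX_p + PRINT**, IDX_p = «at every imaginary quadratic `K` (`d_K < −4`, Heegner for `N_W`, `p` split) with `L(W^{(d_K)},1) ≠ 0`,
  every datum / Heegner datum / `P ∈ W(K)` over the complex Heegner point: `#Ш(W_K)[p^∞] · p^{2(ord_p c + ord_p C(W))} = p^{2 ord_p [W(K):ℤP]}`»;
* §3 ★ `idx_of_bsdp_rankLeOne_of_facts` — LOSSLESS;
* §4 ★ `bsdp_rankLeOne_iff_rankZero_and_idx_of_facts` — modulo PRINT + FH: (`BSD_p`, non-CM, `r_an ≤ 1`) ↔ (`BSD_p`, non-CM, `r_an = 0`) ∧ IDX_p.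
For odd `p` the relation IDX_p is the territory of Kolyvagin 1990 / Jetchev 2008 / W. Zhang 2014 (in print under hypotheses); at `p = 2` it is open
(`RankOneTransfer`).  Nothing here is progress on BSD; it is bookkeeping that other rank-one lines may cite by name.

References: [GrossZagier1986] I.(6.3), V.§2 (2.1)–(2.2); [GrossLMS1991] §1 (1.2), §2 Conj. (2.2); [FriedbergHoffstein1995] main theorem;
[Milne1972ArithmeticAV] §1 Thm. 1; [BCDTJAMS2001] Thm. A; [SilvermanAEC2009] VIII.8 Cor. 8.3, C.16; [Kolyvagin1989Izv] Thm. A; [Jetchev2008] Thm. 1.1;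
[WZhang2014] Thm. 1.1; [Miller2011LMS] Def. 1.1.
-/

set_option autoImplicit false
set_option linter.dupNamespace false -- `Summit.<P>.<Sub>` repeats `BirchSwinnertonDyer` (D-0017)

noncomputable section

open scoped Classical

open WeierstrassCurve NumberField Literature.NumberTheory.EllipticCurves
  Literature.NumberTheory.EllipticCurves.ModularForms
  Literature.NumberTheory.EllipticCurves.Rank1Residual
  Literature.NumberTheory.EllipticCurves.Rank1Residual.Typed
  Literature.NumberTheory.EllipticCurves.KrizLi2019
  Summit.BirchSwinnertonDyer.Rank1Residual
  Summit.BirchSwinnertonDyer.Rank1Residual.AdditivePotMult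
  Summit.BirchSwinnertonDyer.BirchSwinnertonDyer.Rank1Residual
  Summit.BirchSwinnertonDyer.BirchSwinnertonDyer.Theorems.CMExactDescent
  Summit.BirchSwinnertonDyer.BirchSwinnertonDyer.Theorems.GenusExact.TwinSwap
  Summit.BirchSwinnertonDyer.BirchSwinnertonDyer.Theorems.GenusExact.TwinSwap.IdentityDoor

open Summit.BirchSwinnertonDyer.BirchSwinnertonDyer.Theorems.GenusExact.TwinSwap.Ledger.Line25
  (exists_kolyvaginHeegnerData_one_of_nonempty_modularParametrizationData)

namespace Summit.BirchSwinnertonDyer.BirchSwinnertonDyer.Theorems.GenusExact.TwinSwap.RankOneTransferAnyPrime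

variable (p : ℕ) [hp : Fact p.Prime]

/-! ## §1 The index relation gives the p-part over `K` -/

/-- **IDX_p ⟹ `MissingPPartOverCAt (W ⊗ K) p`, for ANY rank-one `W` and ANY prime `p`.**  `W/ℚ` globally minimal with `r_an(W) = 1`; `K` imaginary quadratic with
`d_K < −4`, Heegner for `N_W`, `L(W^{(d_K)},1) ≠ 0`; a datum `Dt`, a Heegner datum `H`, `P ∈ W(K)` over the complex Heegner point; PRINT `hGZ`, `hGZK`, `hmod`.  If
`#Ш(W_K)[p^∞] · p^{2(ord_p c + ord_p C(W))} = p^{2 ord_p [W(K) : ℤP]}` then `ord_p #Ш_an(W_K) = ord_p #Ш(W_K)`; also `Ш(W_K)` is finite and `P` has infinite order.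
[cite: GrossZagier1986, Thm. I.6.3, V.(2.1)–(2.2)] [cite: GrossLMS1991, §2 Conj. (2.2)] -/
theorem missingPPartOverCAt_baseChange_of_idx
    (W : WeierstrassCurve ℚ) [W.IsElliptic] [W.IsGloballyMinimal] [NeZero (W.conductorNorm ℤ)]
    (K : Type) [Field K] [NumberField K]
    (hGZ : gross_zagier (W.conductorNorm ℤ) W K) (hGZK : rank_eq_analyticRank_of_analyticRank_le_one) (hmod : hasEntireLFunction_rat)
    (hr : W.analyticRank = 1) (hK : IsImaginaryQuadratic K) (hlt : NumberField.discr K < -4)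
    (hH : SatisfiesHeegnerHypothesis (W.conductorNorm ℤ) K)
    (hL : (W.quadraticTwist (NumberField.discr K : ℚ)).entireLFunction 1 ≠ 0)
    (Dt : ModularParametrizationData W (W.conductorNorm ℤ)) (H : HeegnerDatum (W.conductorNorm ℤ) (NumberField.discr K))
    (ι : K →+* ℂ) (P : (W.baseChange K).toAffine.Point)
    (hP : WeierstrassCurve.Affine.Point.map ι.toRatAlgHom P = heegnerPointComplex Dt H)
    (hidx : Nat.card (AddCommGroup.primaryComponent (W.baseChange K).sha p) *
        p ^ (2 * (padicValInt p Dt.c + padicValNat p W.tamagawaProduct)) =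
      p ^ (2 * padicValNat p (AddSubgroup.zmultiples P).index)) :
    MissingPPartOverCAt (W.baseChange K) p ∧ Finite (W.baseChange K).sha ∧ ¬ IsOfFinAddOrder P := by
  haveI hEK : (W.baseChange K).IsElliptic := isElliptic_baseChange' W K
  have h2 : Module.finrank ℚ K = 2 := hK.1
  have hD0 : (NumberField.discr K : ℚ) ≠ 0 := by exact_mod_cast NumberField.discr_ne_zero K
  haveI hEt : (W.quadraticTwist (NumberField.discr K : ℚ)).IsElliptic := W.isElliptic_quadraticTwist hD0
  have hw2 : Units.torsionOrder K = 2 :=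
    Literature.NumberTheory.QuadraticFields.Quadratic.torsionOrder_eq_two_of_discr_lt_neg_four h2 hlt
  have hc0 : Dt.c ≠ 0 := fun h ↦ Dt.cast_c_ne_zero (by rw [h, Int.cast_zero])
  -- analytic ranks: `r_an(W^{(d_K)}) = 0`, so `r_an(W_K) = 1`
  have hrt : (W.quadraticTwist (NumberField.discr K : ℚ)).analyticRank = 0 :=
    ((W.quadraticTwist (NumberField.discr K : ℚ)).analyticRank_eq_zero_iff_holds (hmod _)).mpr hL
  have hrK : (W.baseChange K).analyticRank = 1 :=
    (P2.analyticRank_baseChange_eq_one_iff W K hmod h2).mpr (Or.inl ⟨hr, hrt⟩)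
  -- Gross–Zagier over `K`, exact form
  obtain ⟨hrkK, hShaK, hPinf, hshaC⟩ := shaAnOverC_baseChange_eq_of_heegner W K Dt H ι P hGZ hGZK hmod hK hH hP hc0 hrK
  haveI hfinK : Finite (W.baseChange K).sha := hShaK
  set I := (AddSubgroup.zmultiples P).index with hI_def
  have hI0 : I ≠ 0 := fun hI ↦ by
    have hh := P2.torsionOrder_sq_mul_canonicalHeight_eq_index_sq_mul_regulator (W.baseChange K) hrkK P hPinf
    rw [← hI_def, hI, Nat.cast_zero, zero_pow two_ne_zero, zero_mul, mul_eq_zero, pow_eq_zero_iff two_ne_zero,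
      Nat.cast_eq_zero] at hh
    exact hh.elim (W.baseChange K).torsionOrder_pos_holds.ne'
      (fun h0 ↦ hPinf ((Affine.Point.canonicalHeight_eq_zero_iff_holds P).mp h0))
  set q : ℚ := 4 * (I : ℚ) ^ 2 /
      ((Dt.c : ℚ) ^ 2 * (Units.torsionOrder K : ℚ) ^ 2 * ((W.tamagawaProduct : ℚ) ^ 2)) with hq_def
  have hcQ0 : (Dt.c : ℚ) ≠ 0 := by exact_mod_cast hc0
  have hcW0 : (W.tamagawaProduct : ℚ) ≠ 0 := by exact_mod_cast W.tamagawaProduct_pos_holds.ne'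
  have hIQ0 : (I : ℚ) ≠ 0 := by exact_mod_cast hI0
  have hq' : q = ((I : ℚ) / ((Dt.c : ℚ) * (W.tamagawaProduct : ℚ))) ^ 2 := by
    rw [hq_def, hw2]
    push_cast
    field_simp
    ring
  have hvc : padicValRat p (Dt.c : ℚ) = padicValInt p Dt.c := padicValRat.of_int
  have hval : padicValRat p q =
      2 * (padicValNat p I : ℤ) - 2 * (padicValInt p Dt.c : ℤ) - 2 * (padicValNat p W.tamagawaProduct : ℤ) := by
    rw [hq', padicValRat.pow, padicValRat.div hIQ0 (mul_ne_zero hcQ0 hcW0), padicValRat.mul hcQ0 hcW0, hvc, padicValRat.of_nat,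
      padicValRat.of_nat]
    push_cast
    ring
  -- `ord_p #Ш(W_K) = 2 ord_p I − 2 ord_p c − 2 ord_p C(W)` from IDX_p
  have hp1 : p ≠ 0 := hp.out.ne_zero
  have hcard_pos : 0 < Nat.card (AddCommGroup.primaryComponent (W.baseChange K).sha p) := Nat.card_pos
  have hshaV : (padicValNat p (W.baseChange K).shaOrder : ℤ) =
      2 * (padicValNat p I : ℤ) - 2 * (padicValInt p Dt.c : ℤ) - 2 * (padicValNat p W.tamagawaProduct : ℤ) := by
    rw [X11b.Three.Koly.padicValNat_shaOrder_eq (W.baseChange K) p]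
    have h := congrArg (padicValNat p) hidx
    rw [padicValNat.mul hcard_pos.ne' (pow_ne_zero _ hp1), padicValNat.prime_pow, padicValNat.prime_pow] at h
    omega
  exact ⟨⟨q, hshaC, by rw [hval, hshaV]⟩, hShaK, hPinf⟩

/-! ## §2 `BSD_p` for every non-CM rank-one curve from the rank-zero statement, Friedberg–Hoffstein, IDX_p and PRINT -/

/-- ★ **THE RANK-ONE TRANSFER AT THE PRIME `p`: `BSD_p` for EVERY non-CM globally minimal `W` with `r_an(W) = 1` ⟸ (`BSD_p` for non-CM rank-`0` curves) + FH +
IDX_p + PRINT.**  NO Selmer / torsion / sign / image / Tamagawa / reduction hypothesis on `W`.  Proof: datum (BCDT) + parity ⟹ `w(W) = −1`; Friedberg–Hoffstein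
with the prime `p` ⟹ `K` (Heegner, `p` split, `|d_K| > 4`, `L(W^{(d_K)},1) ≠ 0`); Néron minimal model of the twist, non-CM of analytic rank `0`, `BSD_p` by the
rank-zero statement; conductor-`1` datum over `K` and its Heegner point `P ∈ W(K)`; IDX_p; §1; Milne any model.  CONDITIONAL; proves nothing about BSD;
closes nothing.  [cite: FriedbergHoffstein1995, main theorem] [cite: GrossZagier1986, V.§2 (2.2)] [cite: Milne1972ArithmeticAV, §1 Thm. 1]
[cite: SilvermanAEC2009, VIII.8 Cor. 8.3] [cite: BCDTJAMS2001, Thm. A] -/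
theorem bsdp_rankOne_of_rankZero_of_friedbergHoffstein_of_idx_of_facts
    (hGZ : ∀ (N : ℕ) [NeZero N] (W : WeierstrassCurve ℚ) (K : Type) [Field K] [NumberField K], gross_zagier N W K)
    (hGZK : rank_eq_analyticRank_of_analyticRank_le_one) (hmod : hasEntireLFunction_rat)
    (hMilneC : Milne1972.bsdQuotient_baseChange_quadratic_anyModel) (hMP : nonempty_modularParametrizationData)
    (hFH : friedbergHoffstein_exists_heegnerField_split_twist_ne_zero)
    (hS1 : ∀ (W : WeierstrassCurve ℚ) [W.IsElliptic] [W.IsGloballyMinimal], ¬ W.HasCM → W.analyticRank = 0 → BSDp W p)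
    (hIDX : ∀ (W : WeierstrassCurve ℚ) [W.IsElliptic] [W.IsGloballyMinimal] [NeZero (W.conductorNorm ℤ)],
      ¬ W.HasCM → W.analyticRank = 1 →
      ∀ (K : Type) [Field K] [NumberField K], IsImaginaryQuadratic K → NumberField.discr K < -4 →
        SatisfiesHeegnerHypothesis (W.conductorNorm ℤ) K → SatisfiesHeegnerHypothesis p K →
        (W.quadraticTwist (NumberField.discr K : ℚ)).entireLFunction 1 ≠ 0 →
        ∀ (Dt : ModularParametrizationData W (W.conductorNorm ℤ)) (H : HeegnerDatum (W.conductorNorm ℤ) (NumberField.discr K))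
          (ι : K →+* ℂ) (P : (W.baseChange K).toAffine.Point),
          WeierstrassCurve.Affine.Point.map ι.toRatAlgHom P = heegnerPointComplex Dt H →
          Nat.card (AddCommGroup.primaryComponent (W.baseChange K).sha p) *
              p ^ (2 * (padicValInt p Dt.c + padicValNat p W.tamagawaProduct)) =
            p ^ (2 * padicValNat p (AddSubgroup.zmultiples P).index)) :
    ∀ (W : WeierstrassCurve ℚ) [W.IsElliptic] [W.IsGloballyMinimal], ¬ W.HasCM → W.analyticRank = 1 → BSDp W p := by
  intro W _ _ hcm hr
  haveI : NeZero (W.conductorNorm ℤ) := ⟨(W.conductorNorm_pos_holds).ne'⟩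
  -- the sign of the functional equation: `w(W) = −1` from `r_an(W) = 1`
  obtain ⟨Dt₀⟩ := hMP W
  have hw : W.rootNumber = -1 := by
    rcases Literature.NumberTheory.EllipticCurves.rootNumber_eq_one_or_eq_neg_one W with h1 | h1
    · exfalso
      have hev : Even W.analyticRank :=
        (Literature.Barriers.BirchSwinnertonDyer.even_analyticRank_iff_of_isNewformOf_conductorLevel Dt₀.isNewformOf).mpr h1
      rw [hr] at hev
      exact Nat.not_even_one hev
    · exact h1
  -- Friedberg–Hoffstein at the prime `p`
  obtain ⟨K, _, _, hK, hB, hH, hpH, hL⟩ := hFH W hw p hp.out 4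
  have h2 : Module.finrank ℚ K = 2 := hK.1
  have hlt : NumberField.discr K < -4 := by
    have hneg := hK.discr_neg
    omega
  -- a globally minimal model of the twist: non-CM of analytic rank 0, `BSD_p` by the rank-zero statement
  have hD0 : (NumberField.discr K : ℚ) ≠ 0 := by exact_mod_cast NumberField.discr_ne_zero K
  haveI := W.isElliptic_quadraticTwist hD0
  obtain ⟨Cd, hmin⟩ := hasGlobalMinimalModel_rat_holds (W.quadraticTwist (NumberField.discr K : ℚ))
  haveI := hmin
  have hcmd : ¬ (Cd • W.quadraticTwist (NumberField.discr K : ℚ)).HasCM := by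
    rw [hasCM_iff_of_j_eq (((W.quadraticTwist (NumberField.discr K : ℚ)).variableChange_j Cd).trans (W.j_quadraticTwist hD0))]
    exact hcm
  have hrd : (Cd • W.quadraticTwist (NumberField.discr K : ℚ)).analyticRank = 0 := by
    rw [analyticRank_smul]
    exact ((W.quadraticTwist (NumberField.discr K : ℚ)).analyticRank_eq_zero_iff_holds (hmod _)).mpr hL
  have hBd : BSDp (Cd • W.quadraticTwist (NumberField.discr K : ℚ)) p := hS1 _ hcmd hrd
  -- a conductor-1 datum over `K` and its Heegner point `P ∈ W(K)`
  obtain ⟨Dt, β, ι, d₁, -⟩ := exists_kolyvaginHeegnerData_one_of_nonempty_modularParametrizationData hMP W K hK hH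
  obtain ⟨P, H, hP, -⟩ := exists_heegnerPoint_map_eq_derivedPoint_one hK hH d₁
  -- IDX_p and §1
  have hidx := hIDX W hcm hr K hK hlt hH hpH hL Dt H ι P hP
  obtain ⟨hKin, -, -⟩ := missingPPartOverCAt_baseChange_of_idx p W K (hGZ _ W K) hGZK hmod hr hK hlt hH hL Dt H ι P hP hidx
  exact bsdp_of_pPartOverC_baseChange W p K (Cd • W.quadraticTwist (NumberField.discr K : ℚ)) hGZK hmod hMilneC (le_of_eq hr) h2 ⟨Cd, rfl⟩
    (by rw [hrd]; exact zero_le_one) hKin hBd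

/-! ## §3 Losslessness -/

/-- ★ **IDX_p IS LOSSLESS: `BSD_p` for non-CM curves of analytic rank ≤ 1 + PRINT ⟹ IDX_p** (text VERBATIM; FH not needed).  The Néron minimal model of the
twist is non-CM of analytic rank `0`; the BSD pair + Milne give `MissingPPartOverCAt (W ⊗ K) p`; Gross–Zagier over `K` reads it as the index relation.
CONDITIONAL; proves nothing about BSD; closes nothing.  [cite: GrossZagier1986, V.§2 (2.2)] [cite: Milne1972ArithmeticAV, §1 Thm. 1] [cite: Miller2011LMS, Def. 1.1] -/
theorem idx_of_bsdp_rankLeOne_of_facts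
    (hGZ : ∀ (N : ℕ) [NeZero N] (W : WeierstrassCurve ℚ) (K : Type) [Field K] [NumberField K], gross_zagier N W K)
    (hGZK : rank_eq_analyticRank_of_analyticRank_le_one) (hmod : hasEntireLFunction_rat)
    (hMilneC : Milne1972.bsdQuotient_baseChange_quadratic_anyModel)
    (hS1 : ∀ (W : WeierstrassCurve ℚ) [W.IsElliptic] [W.IsGloballyMinimal], ¬ W.HasCM → W.analyticRank = 0 → BSDp W p)
    (hR1 : ∀ (W : WeierstrassCurve ℚ) [W.IsElliptic] [W.IsGloballyMinimal], ¬ W.HasCM → W.analyticRank = 1 → BSDp W p) :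
    ∀ (W : WeierstrassCurve ℚ) [W.IsElliptic] [W.IsGloballyMinimal] [NeZero (W.conductorNorm ℤ)],
      ¬ W.HasCM → W.analyticRank = 1 →
      ∀ (K : Type) [Field K] [NumberField K], IsImaginaryQuadratic K → NumberField.discr K < -4 →
        SatisfiesHeegnerHypothesis (W.conductorNorm ℤ) K → SatisfiesHeegnerHypothesis p K →
        (W.quadraticTwist (NumberField.discr K : ℚ)).entireLFunction 1 ≠ 0 →
        ∀ (Dt : ModularParametrizationData W (W.conductorNorm ℤ)) (H : HeegnerDatum (W.conductorNorm ℤ) (NumberField.discr K))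
          (ι : K →+* ℂ) (P : (W.baseChange K).toAffine.Point),
          WeierstrassCurve.Affine.Point.map ι.toRatAlgHom P = heegnerPointComplex Dt H →
          Nat.card (AddCommGroup.primaryComponent (W.baseChange K).sha p) *
              p ^ (2 * (padicValInt p Dt.c + padicValNat p W.tamagawaProduct)) =
            p ^ (2 * padicValNat p (AddSubgroup.zmultiples P).index) := by
  intro W _ _ _ hcm hr K _ _ hK hlt hH _hpH hL Dt H ι P hP
  haveI hEK : (W.baseChange K).IsElliptic := isElliptic_baseChange' W K
  have h2 : Module.finrank ℚ K = 2 := hK.1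
  have hD0 : (NumberField.discr K : ℚ) ≠ 0 := by exact_mod_cast NumberField.discr_ne_zero K
  haveI hEt : (W.quadraticTwist (NumberField.discr K : ℚ)).IsElliptic := W.isElliptic_quadraticTwist hD0
  obtain ⟨Cd, hmin⟩ := hasGlobalMinimalModel_rat_holds (W.quadraticTwist (NumberField.discr K : ℚ))
  haveI := hmin
  have hcmd : ¬ (Cd • W.quadraticTwist (NumberField.discr K : ℚ)).HasCM := by
    rw [hasCM_iff_of_j_eq (((W.quadraticTwist (NumberField.discr K : ℚ)).variableChange_j Cd).trans (W.j_quadraticTwist hD0))]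
    exact hcm
  have hrt : (W.quadraticTwist (NumberField.discr K : ℚ)).analyticRank = 0 :=
    ((W.quadraticTwist (NumberField.discr K : ℚ)).analyticRank_eq_zero_iff_holds (hmod _)).mpr hL
  have hrd : (Cd • W.quadraticTwist (NumberField.discr K : ℚ)).analyticRank = 0 := by rw [analyticRank_smul, hrt]
  have hBd : BSDp (Cd • W.quadraticTwist (NumberField.discr K : ℚ)) p := hS1 _ hcmd hrd
  have hBW : BSDp W p := hR1 W hcm hr
  have hw2 : Units.torsionOrder K = 2 :=
    Literature.NumberTheory.QuadraticFields.Quadratic.torsionOrder_eq_two_of_discr_lt_neg_four h2 hlt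
  have hc0 : Dt.c ≠ 0 := fun h ↦ Dt.cast_c_ne_zero (by rw [h, Int.cast_zero])
  have hrK : (W.baseChange K).analyticRank = 1 :=
    (P2.analyticRank_baseChange_eq_one_iff W K hmod h2).mpr (Or.inl ⟨hr, hrt⟩)
  obtain ⟨hrkK, hShaK, hPinf, hshaC⟩ := shaAnOverC_baseChange_eq_of_heegner W K Dt H ι P (hGZ _ W K) hGZK hmod hK hH hP hc0 hrK
  haveI hfinK : Finite (W.baseChange K).sha := hShaK
  set I := (AddSubgroup.zmultiples P).index with hI_def
  have hI0 : I ≠ 0 := fun hI ↦ by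
    have hh := P2.torsionOrder_sq_mul_canonicalHeight_eq_index_sq_mul_regulator (W.baseChange K) hrkK P hPinf
    rw [← hI_def, hI, Nat.cast_zero, zero_pow two_ne_zero, zero_mul, mul_eq_zero, pow_eq_zero_iff two_ne_zero,
      Nat.cast_eq_zero] at hh
    exact hh.elim (W.baseChange K).torsionOrder_pos_holds.ne'
      (fun h0 ↦ hPinf ((Affine.Point.canonicalHeight_eq_zero_iff_holds P).mp h0))
  set q : ℚ := 4 * (I : ℚ) ^ 2 /
      ((Dt.c : ℚ) ^ 2 * (Units.torsionOrder K : ℚ) ^ 2 * ((W.tamagawaProduct : ℚ) ^ 2)) with hq_def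
  have hcQ0 : (Dt.c : ℚ) ≠ 0 := by exact_mod_cast hc0
  have hcW0 : (W.tamagawaProduct : ℚ) ≠ 0 := by exact_mod_cast W.tamagawaProduct_pos_holds.ne'
  have hIQ0 : (I : ℚ) ≠ 0 := by exact_mod_cast hI0
  have hq' : q = ((I : ℚ) / ((Dt.c : ℚ) * (W.tamagawaProduct : ℚ))) ^ 2 := by
    rw [hq_def, hw2]
    push_cast
    field_simp
    ring
  have hvc : padicValRat p (Dt.c : ℚ) = padicValInt p Dt.c := padicValRat.of_int
  have hval : padicValRat p q =
      2 * (padicValNat p I : ℤ) - 2 * (padicValInt p Dt.c : ℤ) - 2 * (padicValNat p W.tamagawaProduct : ℤ) := by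
    rw [hq', padicValRat.pow, padicValRat.div hIQ0 (mul_ne_zero hcQ0 hcW0), padicValRat.mul hcQ0 hcW0, hvc, padicValRat.of_nat,
      padicValRat.of_nat]
    push_cast
    ring
  obtain ⟨q', hq'', hv'⟩ :=
    (missingPPartOverCAt_baseChange_iff_bsdp W p K (Cd • W.quadraticTwist (NumberField.discr K : ℚ)) hGZK hmod hMilneC (by rw [hr]) h2
      ⟨Cd, rfl⟩ (by rw [hrd]; exact zero_le_one) hBd).mpr hBW
  have hqq : q' = q := Rat.cast_injective (α := ℂ) (hq''.symm.trans hshaC)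
  rw [hqq, hval, X11b.Three.Koly.padicValNat_shaOrder_eq (W.baseChange K) p] at hv'
  obtain ⟨k, hk⟩ := X11b.SelmerCount.exists_natCard_primaryComponent_eq_pow_of_finite p (G := (W.baseChange K).sha)
  rw [hk, padicValNat.prime_pow] at hv'
  have hk' : (k : ℤ) = 2 * (padicValNat p I : ℤ) - 2 * (padicValInt p Dt.c : ℤ) - 2 * (padicValNat p W.tamagawaProduct : ℤ) := by
    exact_mod_cast hv'.symm
  have hkeq : k + 2 * (padicValInt p Dt.c + padicValNat p W.tamagawaProduct) = 2 * padicValNat p I := by omega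
  rw [hk, ← pow_add, hkeq]

/-! ## §4 Modulo PRINT + FH: (`BSD_p`, non-CM, `r_an ≤ 1`) ⟺ (`BSD_p`, non-CM, `r_an = 0`) ∧ IDX_p -/

/-- ★ **AT EVERY PRIME `p`, modulo PRINT + Friedberg–Hoffstein: «`BSD_p` for every non-CM globally minimal curve of analytic rank `≤ 1`» ↔ «`BSD_p` for every
non-CM globally minimal curve of analytic rank `0`» ∧ IDX_p.**  (At `p = 2` the left side is the K4 leaf `Rank1Residual.NonCMAtTwo`: `RankOneTransfer`.)
A CENSUS statement: nothing about BSD is proved.  [cite: GrossZagier1986, V.§2 (2.2)] [cite: FriedbergHoffstein1995, main theorem] [cite: Miller2011LMS, Def. 1.1] -/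
theorem bsdp_rankLeOne_iff_rankZero_and_idx_of_facts
    (hGZ : ∀ (N : ℕ) [NeZero N] (W : WeierstrassCurve ℚ) (K : Type) [Field K] [NumberField K], gross_zagier N W K)
    (hGZK : rank_eq_analyticRank_of_analyticRank_le_one) (hmod : hasEntireLFunction_rat)
    (hMilneC : Milne1972.bsdQuotient_baseChange_quadratic_anyModel) (hMP : nonempty_modularParametrizationData)
    (hFH : friedbergHoffstein_exists_heegnerField_split_twist_ne_zero) :
    (∀ (W : WeierstrassCurve ℚ) [W.IsElliptic] [W.IsGloballyMinimal], ¬ W.HasCM → W.analyticRank ≤ 1 → BSDp W p) ↔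
      ((∀ (W : WeierstrassCurve ℚ) [W.IsElliptic] [W.IsGloballyMinimal], ¬ W.HasCM → W.analyticRank = 0 → BSDp W p) ∧
      ∀ (W : WeierstrassCurve ℚ) [W.IsElliptic] [W.IsGloballyMinimal] [NeZero (W.conductorNorm ℤ)],
      ¬ W.HasCM → W.analyticRank = 1 →
      ∀ (K : Type) [Field K] [NumberField K], IsImaginaryQuadratic K → NumberField.discr K < -4 →
        SatisfiesHeegnerHypothesis (W.conductorNorm ℤ) K → SatisfiesHeegnerHypothesis p K →
        (W.quadraticTwist (NumberField.discr K : ℚ)).entireLFunction 1 ≠ 0 →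
        ∀ (Dt : ModularParametrizationData W (W.conductorNorm ℤ)) (H : HeegnerDatum (W.conductorNorm ℤ) (NumberField.discr K))
          (ι : K →+* ℂ) (P : (W.baseChange K).toAffine.Point),
          WeierstrassCurve.Affine.Point.map ι.toRatAlgHom P = heegnerPointComplex Dt H →
          Nat.card (AddCommGroup.primaryComponent (W.baseChange K).sha p) *
              p ^ (2 * (padicValInt p Dt.c + padicValNat p W.tamagawaProduct)) =
            p ^ (2 * padicValNat p (AddSubgroup.zmultiples P).index)) := by
  refine ⟨fun h ↦ ?_, fun ⟨hS1, hIDX⟩ W _ _ hcm hr ↦ ?_⟩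
  · have hS1 : ∀ (W : WeierstrassCurve ℚ) [W.IsElliptic] [W.IsGloballyMinimal], ¬ W.HasCM → W.analyticRank = 0 → BSDp W p :=
      fun W _ _ hcm hr0 ↦ h W hcm (by rw [hr0]; exact zero_le_one)
    exact ⟨hS1, idx_of_bsdp_rankLeOne_of_facts p hGZ hGZK hmod hMilneC hS1 fun W _ _ hcm hr1 ↦ h W hcm (le_of_eq hr1)⟩
  · rcases Nat.le_one_iff_eq_zero_or_eq_one.mp hr with hr0 | hr1
    · exact hS1 W hcm hr0
    · exact bsdp_rankOne_of_rankZero_of_friedbergHoffstein_of_idx_of_facts p hGZ hGZK hmod hMilneC hMP hFH hS1 hIDX W hcm hr1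

end Summit.BirchSwinnertonDyer.BirchSwinnertonDyer.Theorems.GenusExact.TwinSwap.RankOneTransferAnyPrime

end
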